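import Mathlib
import Summits.KontsevichZagierPeriods.Zeta5Search.BrickStepF
import Summits.KontsevichZagierPeriods.Zeta5Search.BrickDigitStepD

/-!
# BrickDigitSide — THEOREM 6, DIGIT SIDE (Addendum, `s ≥ 1`): `Σ_{j=0}^{n} D_j^{(s)} ≡ 0 (mod p³)` for every
`n < p²`, `p ≥ 5`, `A` even, `2 ≤ 2B ≤ A`, `1 ≤ s ≤ A − 1` — a KERNEL THEOREM (cell zeta5-irr)

HONEST FRAMING: systematic search; no irrationality claim unless certified. INSTRUMENT theorem of the ζ(5)
census cell zeta5-irr (HOME `run/shared/lean/pub/zeta5-irr/`; memo `zi-p2/probes/B8/thm6/THEOREM6.md` §1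
«**Addendum (all s).** Under the same hypotheses `Σ_{j=0}^{n}D_j^{(s)} ≡ 0 (mod p³)`», `D_j^{(s)} :=
p^{τ_s}(p^{τ_s}cell_{jp}^{(s)}(np) − cell_j^{(s)}(n))`, `τ_s = A−1−s`; proof = Steps D (D3) + E⁺ (E1⁺) + F (F5) with
LEMMA Φ4 and Wolstenholme). Nothing here is about ζ(5); no irrationality content; filing moves no rung (zi-p2's
THEOREM 6 is a certified instrument-tier statement; this file puts its digit half for the cells `s ≥ 1` in the
kernel; the harmonic cell `s = 0` and the off-digit half (Step G⁺) are NOT here). Filed by the engine seat zi-eng (g8):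
assembly of `BrickDigitStepD.digitD_sub_le` (Step D), `BrickPhiFour.padicValuation_brickPhi_sub_le` (LEMMA Φ4:
`Φ(−j) − 1 ≡ λ_p q_n(j) (mod p⁴)`, `λ_p = pH_{p−1}`), `BrickPhiFour.padicValuation_prime_mul_harmonic_le` (Wolstenholme:
`v_p(λ_p) ≥ 3`), `BrickStepF.stepF` (`Σ_j q_n(j)ρ_j ≡ 0 (mod p)`), `BrickTopKummer.cell_one_valuation_abs` (C3⁺).

## The statement

For a prime `p ≥ 5`, `A` even, `2 ≤ 2B ≤ A`, `n < p²`, `s + 1 ≤ A`, with `digitD A B p 1 n j s =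
p^{τ_s}·(p^{τ_s}·c_{jp,s}(np) − c_{j,s}(n))` (`BrickDigitStepD`, level `L = 1`):

**`v(Σ_{j=0}^{n} digitD A B p 1 n j s) ≤ exp(−3)`**, i.e. `Σ_{j≤n} D_j^{(s)} ≡ 0 (mod p³)` (`sum_digitD_le`).

Chain: `D_j ≡ p^{τ}(Φ(−j)−1)c_{j,s}` (Step D) `≡ λ_p·q_n(j)·p^{τ}c_{j,s} (mod p³)` (Φ4, `v(p^τc_{j,s}) ≥ −1`), and
`Σ_j λ_p q_n(j) p^{τ}c_{j,s} = H_{p−1}·Σ_j q_n(j)·p^{A−s}c_{j,s}` has valuation `≥ 2 + 1` (Wolstenholme + Step F).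
-/

namespace Summit.KontsevichZagierPeriods.Zeta5Search.BrickDigitSide

open Finset Nat WithZero
open Summit.KontsevichZagierPeriods.Zeta5Search.BrickKernelFrobenius (brickPhi)
open Summit.KontsevichZagierPeriods.Zeta5Search.BrickPhiFour (phiMoment padicValuation_brickPhi_sub_le
  padicValuation_prime_mul_harmonic_le)
open Summit.KontsevichZagierPeriods.Zeta5Search.BrickLaurent (cell phiCoeff phiCoeff_zero)
open Summit.KontsevichZagierPeriods.Zeta5Search.BrickTopKummer (cell_one_valuation_abs)
open Summit.KontsevichZagierPeriods.Zeta5Search.BrickDigitStepD (digitD digitD_sub_le)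
open Summit.KontsevichZagierPeriods.Zeta5Search.BrickStepF (stepF)

noncomputable section

variable {p : ℕ} [Fact p.Prime]

/-- Discreteness: `v(y) < 1` implies `v(y) ≤ exp(−1)`. -/
theorem le_exp_neg_one_of_lt_one {y : ℚ} (h : Rat.padicValuation p y < 1) : Rat.padicValuation p y ≤ exp (-1) := by
  by_cases hy : y = 0
  · rw [hy, map_zero]; exact _root_.zero_le
  · have e : Rat.padicValuation p y = exp (-padicValRat p y) := if_neg hy
    rw [e, ← exp_zero, exp_lt_exp] at h
    rw [e, exp_le_exp]
    omega

/-- **THEOREM 6, DIGIT SIDE for the cells `s ≥ 1`**: `p ≥ 5`, `A` even, `2 ≤ 2B ≤ A`, `n < p²`, `s + 1 ≤ A` ⇒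
`v_p(Σ_{j=0}^{n} D_j^{(s)}) ≥ 3`. -/
theorem sum_digitD_le (h3 : 3 < p) {A B n s : ℕ} (hA : Even A) (hAB : 2 * B ≤ A) (hB : 1 ≤ B) (hn : n < p ^ 2)
    (hs : s + 1 ≤ A) : Rat.padicValuation p (∑ j ∈ range (n + 1), digitD A B p 1 n j s) ≤ exp (-3) := by
  have hp : p.Prime := Fact.out
  have hp2 : p ≠ 2 := by omega
  have hpQ : (p : ℚ) ≠ 0 := by exact_mod_cast hp.ne_zero
  set lam : ℚ := (p : ℚ) * harmonic (p - 1) with hlam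
  set τ : ℕ := A - 1 - s with hτ
  -- termwise: `D_j ≡ λ_p·p^τ·q_n(j)·c_{j,s}(n) (mod p³)`
  have hterm : ∀ j ∈ range (n + 1), Rat.padicValuation p
      (digitD A B p 1 n j s - lam * (p : ℚ) ^ τ * ((phiMoment A B n ((j : ℕ) : ℤ) : ℚ) * cell A B 1 n j s)) ≤ exp (-3) := by
    intro j hj
    have hjn : j ≤ n := by have := mem_range.1 hj; omega
    have hD := digitD_sub_le (p := p) h3 hAB (L := 1) (by simpa using hn) hjn hs
    rw [one_mul] at hD
    have hΦ := padicValuation_brickPhi_sub_le (p := p) h3 hAB n (j : ℤ)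
    rw [← phiCoeff_zero hp hp2 A B n (j : ℤ)] at hΦ
    have hc : Rat.padicValuation p ((p : ℚ) ^ τ * cell A B 1 n j s) ≤ exp 1 := by
      rw [map_mul, map_pow, Rat.padicValuation_self, ← exp_nsmul]
      refine (mul_le_mul' le_rfl (cell_one_valuation_abs hp2 hAB (L := 1) (by simpa using hn) hjn s)).trans ?_
      rw [← exp_add, exp_le_exp, hτ]; push_cast [show s ≤ A by omega]; simp; omega
    rw [show digitD A B p 1 n j s - lam * (p : ℚ) ^ τ * ((phiMoment A B n ((j : ℕ) : ℤ) : ℚ) * cell A B 1 n j s) =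
      (digitD A B p 1 n j s - (p : ℚ) ^ (A - 1 - s) * (phiCoeff A B p n j 0 - 1) * cell A B 1 n j s) +
        (phiCoeff A B p n j 0 - 1 - lam * (phiMoment A B n ((j : ℕ) : ℤ) : ℚ)) * ((p : ℚ) ^ τ * cell A B 1 n j s) by
      rw [hlam, hτ]; ring]
    refine (Valuation.map_add _ _ _).trans (max_le hD ?_)
    rw [map_mul]
    calc _ ≤ exp (-4) * exp 1 := mul_le_mul' hΦ hc
      _ = exp (-3) := by rw [← exp_add]; norm_num
  -- the model sum `λ_p·p^τ·Σ_j q_n(j)c_{j,s}(n) = H_{p−1}·Σ_j q_n(j)·p^{A−s}c_{j,s}(n)` has valuation `≥ 2 + 1`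
  have hmodel : Rat.padicValuation p
      (∑ j ∈ range (n + 1), lam * (p : ℚ) ^ τ * ((phiMoment A B n ((j : ℕ) : ℤ) : ℚ) * cell A B 1 n j s)) ≤ exp (-3) := by
    have hrew : ∑ j ∈ range (n + 1), lam * (p : ℚ) ^ τ * ((phiMoment A B n ((j : ℕ) : ℤ) : ℚ) * cell A B 1 n j s) =
        harmonic (p - 1) * ∑ j ∈ range (n + 1),
          (phiMoment A B n ((j : ℕ) : ℤ) : ℚ) * ((p : ℚ) ^ (A - s) * cell A B 1 n j s) := by
      rw [Finset.mul_sum]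
      refine Finset.sum_congr rfl fun j _ => ?_
      rw [hlam, hτ, show A - s = A - 1 - s + 1 by omega, pow_succ]
      ring
    have hH : Rat.padicValuation p (harmonic (p - 1) : ℚ) ≤ exp (-2) := by
      have h := padicValuation_prime_mul_harmonic_le (p := p) h3
      rw [map_mul, Rat.padicValuation_self] at h
      calc Rat.padicValuation p (harmonic (p - 1) : ℚ)
          = exp 1 * (exp (-1) * Rat.padicValuation p (harmonic (p - 1) : ℚ)) := by
            rw [← mul_assoc, ← exp_add]; norm_num
        _ ≤ exp 1 * exp (-3) := mul_le_mul' le_rfl h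
        _ = exp (-2) := by rw [← exp_add]; norm_num
    rw [hrew, map_mul]
    calc _ ≤ exp (-2) * exp (-1) := mul_le_mul' hH (le_exp_neg_one_of_lt_one (stepF h3 hA hAB hB hn s))
      _ = exp (-3) := by rw [← exp_add]; norm_num
  -- assemble
  have hsplit : ∑ j ∈ range (n + 1), digitD A B p 1 n j s =
      ∑ j ∈ range (n + 1), (digitD A B p 1 n j s - lam * (p : ℚ) ^ τ * ((phiMoment A B n ((j : ℕ) : ℤ) : ℚ) * cell A B 1 n j s))
      + ∑ j ∈ range (n + 1), lam * (p : ℚ) ^ τ * ((phiMoment A B n ((j : ℕ) : ℤ) : ℚ) * cell A B 1 n j s) := by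
    rw [← Finset.sum_add_distrib]; exact Finset.sum_congr rfl fun j _ => by ring
  rw [hsplit]
  exact (Valuation.map_add _ _ _).trans (max_le (Valuation.map_sum_le _ hterm) hmodel)

end

end Summit.KontsevichZagierPeriods.Zeta5Search.BrickDigitSide
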